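import Mathlib
import HarnessLib
import Summits.HubbardSuperconductivity.HubbardSuperconductivity.Theorems.KLProgrammeKLRegimeEngineTwoLegStepSuccDoorMSProfiles
import Summits.HubbardSuperconductivity.HubbardSuperconductivity.Theorems.KLProgrammeKLRegimeSplitTwoLegSizesMSTubeSuppliers
import Summits.HubbardSuperconductivity.HubbardSuperconductivity.Theorems.KLProgrammeKLRegimeSplitTwoLegSizesMSTubeTop
import Summits.HubbardSuperconductivity.HubbardSuperconductivity.Theorems.KLProgrammeKLRegimeFrameOKDerivBounds

/-!
# K3 ENGINE child `KLRegimeEngineV16` (stmt-HubbardSuperconductivity-20236), stubs `stub_twoLeg_step` / `stub_twoLeg_scale0`, conjunct (E3a-MS-Q):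
# the profile-keyed MS suppliers under the stubs' binders with the increment-symbol sizes ON THE FLAT TUBE ONLY (k3c3-p1 g4)

Cell gate-hubbard-kl, seat hubbard-kl-k3c3-p1 (g4).  Twins of `…EngineTwoLegStepSuccDoorMSProfiles` (p522516) over the tube-keyed suppliers
(`…TwoLegSizesMSTubeSuppliers`, `…MSTubeTop`): the sizes `hσ0/hσ/hε0/hε` of the increment symbols are assumed only on `{q : |frameLevel μ K q| ≤ dT}`
(the engine's flat tube; k3c5-p1 (O2), p1b `…TwoLegCoreTDTube`), the gradient bound of the frame band is `7` (`FrameOK`,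
`TorusFourierL2.norm_fderiv_frameLevel_le_of_frameOK`), and ONE tube condition remains per scale: `msTubeR R U n 7 ≤ dT`
(`msTubeR R U n 7 = 8·Gfr₀|U|·16^{−n}/15·(1 + 7/klCurveD)`), resp. `0 ≤ dT` at the top.

* **`twoLegSizesMSTQ_succ_of_profiles_tube_stub`**, **`twoLegSizesMSTQ_zero_of_profiles_tube_stub`**, **`twoLegSizesMSTQ_top_of_profiles_tube_stub`**.

The assembly with the core conjunct and the nested-leg rates is `twoLegStepV16_of_namedCores_stub hcore (this) hcut hsp` (…SuccDoor) at every scale.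
Proofs only (compositions of landed theorems); no definitions; nothing about the model is asserted.
-/

noncomputable section

namespace Summit.HubbardSuperconductivity.HubbardSuperconductivity.Theorems.EngineV8

set_option linter.dupNamespace false -- summit = problem name (single-conjunct summit), D-0017

open Real Finset Literature.MathematicalPhysics.QuantumLattice Literature.Probability.LatticeModels
open Literature.MathematicalPhysics.QuantumLattice.FermiRG Literature.MathematicalPhysics.QuantumLattice.BandSectorCounting
open Summit.HubbardSuperconductivity.HubbardSuperconductivity.Theorems.KLProgrammeLegKernels
open Summit.HubbardSuperconductivity.HubbardSuperconductivity.Theorems.DispersionFlow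
open Summit.HubbardSuperconductivity.HubbardSuperconductivity.Theorems.PerturbedFermiCurve
open Summit.HubbardSuperconductivity.HubbardSuperconductivity.Theorems.KLRegimeSplit

variable {L M : ℕ} [NeZero L] [NeZero M]

/-! ## The three profile-keyed MS suppliers under the stubs' binders, TUBE symbol sizes -/

/-- **(B) `TwoLegSizesMSTQ … (n+1)` UNDER THE STUB'S BINDERS FROM THE PROFILES, TUBE symbol sizes** (`n + 1 ≤ nScales β`):
`twoLegSizesMSTQ_succ_of_profiles_tube` at the engine package; `G_l = 7` from `FrameOK`; one tube condition `msTubeR R U (n+1) 7 ≤ dT`. -/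
theorem twoLegSizesMSTQ_succ_of_profiles_tube_stub {P : SplitConsts} {R : RenConsts} {c : ℝ} (hR : R.WF2) (hc : 0 < c)
    (hc3 : c ≤ klEngC₃3 P R) {μ : ℝ} (hμ : μ ∈ klWindowC) {U : ℝ} (hU : 0 < U) (hUle : U ≤ klEngU₀4 P R c) {β : ℝ} (hβ : klBetaMin ≤ β)
    (hβc : β ≤ Real.exp (c / U ^ 2)) {K : TrigPolyC4v} (hK : FrameOK R U (nScales β) μ K) {n : ℕ} (hn : n + 1 ≤ nScales β)
    {Kp : ℕ → TrigPolyC4v} (hKp : ∀ p : Fin 2 → ℝ, K.eval p = ∑ m ∈ range (nScales β + 1), (Kp m).eval p)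
    (ha : ∀ m ≤ nScales β, ∀ j ≤ 4, ∀ q : Momentum, ‖iteratedFDeriv ℝ j (evalM (Kp m)) q‖ ≤ pieceSize R U m j)
    {S : ℕ → TrigPolyC4v}
    (hS : ∀ θ, klLocalPart L M β U μ K (n + 1) θ - klLocalPart L M β U μ K n θ =
      (S (nScales β - (n + 1))).eval (klFermiPoint μ K θ))
    {dT : ℝ} {σ : ℕ → ℕ → ℝ} (hσnn : ∀ k l, 0 ≤ σ k l)
    (hσ0 : ∀ k ≤ nScales β - (n + 1), ∀ q : Momentum, |frameLevel μ K q| ≤ dT → |evalM (S k) q| ≤ σ k 0)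
    (hσ : ∀ k ≤ nScales β - (n + 1), ∀ l, 1 ≤ l → l ≤ 5 → ∀ q : Momentum, |frameLevel μ K q| ≤ dT → ‖iteratedFDeriv ℝ l (evalM (S k)) q‖ ≤ σ k l)
    {ε : ℕ → ℕ → ℝ} (hεnn : ∀ m l, 0 ≤ ε m l)
    (hε0 : ∀ m ∈ Ioc (n + 1) (nScales β), ∀ q : Momentum,
      |frameLevel μ K q| ≤ dT → |evalM (fsub (S (m - (n + 1))) (S (m - (n + 1) - 1))) q| ≤ ε m 0)
    (hε : ∀ m ∈ Ioc (n + 1) (nScales β), ∀ l, 1 ≤ l → l ≤ 4 → ∀ q : Momentum,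
      |frameLevel μ K q| ≤ dT → ‖iteratedFDeriv ℝ l (evalM (fsub (S (m - (n + 1))) (S (m - (n + 1) - 1)))) q‖ ≤ ε m l)
    {X : ℝ} (hX : ∀ l ≤ 4, ∀ x : ℝ, ‖iteratedFDeriv ℝ l salmhoferCutoff x‖ ≤ X) (hdT : msTubeR R U (n + 1) 7 ≤ dT)
    {mu nu : ℕ → ℝ} (hmu : ∀ i, 0 ≤ mu i) (hnu : ∀ i, 0 ≤ nu i)
    (hs0 : σ 0 0 ≤ 16 * mu 0 * U ^ 2 / ((4 : ℝ) ^ (n + 1)) ^ 2)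
    (hs1 : ∀ k ≤ nScales β - (n + 1), σ k 1 ≤ 4 * mu 1 * U ^ 2 / ((4 : ℝ) ^ (n + 1)))
    (hs2 : ∀ k ≤ nScales β - (n + 1), σ k 2 ≤ mu 2 * U ^ 2)
    (hs3 : ∀ k ≤ nScales β - (n + 1), σ k 3 ≤ mu 3 * U ^ 2 * ((4 : ℝ) ^ (n + 1)) / 4)
    (hs4 : ∀ k ≤ nScales β - (n + 1), σ k 4 ≤ mu 4 * U ^ 2 * ((4 : ℝ) ^ (n + 1)) ^ 2 / 16)
    (hs5 : ∀ k ≤ nScales β - (n + 1), σ k 5 ≤ mu 5 * U ^ 2 * ((4 : ℝ) ^ (n + 1)) ^ 3 / 64)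
    (he0 : ∀ m ∈ Ioc (n + 1) (nScales β), ε m 0 ≤ nu 0 * U ^ 2 / ((4 : ℝ) ^ (n + 1)) * (R.Gfr 0 * U / ((4 : ℝ) ^ m) ^ 2))
    (he1 : ∀ m ∈ Ioc (n + 1) (nScales β), ε m 1 ≤ nu 1 * U ^ 2 / ((4 : ℝ) ^ (n + 1)) * (R.Gfr 1 * U ^ 2 / ((4 : ℝ) ^ m)))
    (he2 : ∀ m ∈ Ioc (n + 1) (nScales β), ε m 2 ≤ nu 2 * U ^ 2 / ((4 : ℝ) ^ (n + 1)) * (R.Gfr 2 * U ^ 2))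
    (he3 : ∀ m ∈ Ioc (n + 1) (nScales β), ε m 3 ≤ nu 3 * U ^ 2 / ((4 : ℝ) ^ (n + 1)) * (R.Gfr 3 * U ^ 2 * ((4 : ℝ) ^ m)))
    (he4 : ∀ m ∈ Ioc (n + 1) (nScales β), ε m 4 ≤ nu 4 * U ^ 2 / ((4 : ℝ) ^ (n + 1)) * (R.Gfr 4 * U ^ 2 * ((4 : ℝ) ^ m) ^ 2))
    (hfit : ∀ j ≤ 4, msReqSlot X mu nu R (512 * π ^ 8) (2048 * π ^ 8) j ≤ (klEngQ5 P R).CE * klEngGeo5.S 1 * R.Gfr j)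
    (hfit0 : ∀ j ≤ 4, msReqBase0 X mu j ≤ klEngGeo5.S j / 2)
    (hfit1 : ∀ j ≤ 4, U * msReqBase1 X mu R (512 * π ^ 8) (2048 * π ^ 8) j ≤ klEngGeo5.S j / 2) :
    TwoLegSizesMSTQ L M klEngGeo5 (klEngQ5 P R) R β U μ K (n + 1) :=
  have hR' : ∀ j, 0 ≤ R.Gfr j := hR.1.2.2
  twoLegSizesMSTQ_succ_of_profiles_tube (L := L) (M := M) hR' hc (le_klCurveC3_div_sixteen_of_le_klEngC₃3 hR' hc3) hU
    (le_klCurveU0_div_sixteen_of_le_klEngU₀4 hR' hUle) (le_one_of_le_klEngU₀4 hR' hUle) hβ hβc hμ hKp ha hn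
    (continuous_klLocalPart_stub hR hc hc3 hU hUle hβ hβc hμ hK L M (n + 1)) (continuous_klLocalPart_stub hR hc hc3 hU hUle hβ hβc hμ hK L M n)
    hS hσnn hσ0 hσ hεnn hε0 hε hX (TorusFourierL2.norm_fderiv_frameLevel_le_of_frameOK hK) hdT (klEngQ5_CE_nonneg P R)
    (klEngQ5_S'_nonneg P R) hmu hnu hs0 hs1 hs2 hs3 hs4 hs5 he0 he1 he2 he3 he4 hfit hfit0 hfit1

/-- **(M) `TwoLegSizesMSTQ … 0` UNDER THE SCALE-0 STUB'S BINDERS FROM THE PROFILES, TUBE symbol sizes**: `twoLegSizesMSTQ_zero_of_profiles_tube`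
at the engine package (scale-0 profiles; rescaled package lines; tube condition `msTubeR R U 0 7 ≤ dT`). -/
theorem twoLegSizesMSTQ_zero_of_profiles_tube_stub {P : SplitConsts} {R : RenConsts} {c : ℝ} (hR : R.WF2) (hc : 0 < c)
    (hc3 : c ≤ klEngC₃3 P R) {μ : ℝ} (hμ : μ ∈ klWindowC) {U : ℝ} (hU : 0 < U) (hUle : U ≤ klEngU₀4 P R c) {β : ℝ} (hβ : klBetaMin ≤ β)
    (hβc : β ≤ Real.exp (c / U ^ 2)) {K : TrigPolyC4v} (hK : FrameOK R U (nScales β) μ K)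
    {Kp : ℕ → TrigPolyC4v} (hKp : ∀ p : Fin 2 → ℝ, K.eval p = ∑ m ∈ range (nScales β + 1), (Kp m).eval p)
    (ha : ∀ m ≤ nScales β, ∀ j ≤ 4, ∀ q : Momentum, ‖iteratedFDeriv ℝ j (evalM (Kp m)) q‖ ≤ pieceSize R U m j)
    {S : ℕ → TrigPolyC4v}
    (hS : ∀ θ, klLocalPart L M β U μ K 0 θ - K.eval (klFermiPoint μ K θ) = (S (nScales β)).eval (klFermiPoint μ K θ))
    {dT : ℝ} {σ : ℕ → ℕ → ℝ} (hσnn : ∀ k l, 0 ≤ σ k l)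
    (hσ0 : ∀ k ≤ nScales β, ∀ q : Momentum, |frameLevel μ K q| ≤ dT → |evalM (S k) q| ≤ σ k 0)
    (hσ : ∀ k ≤ nScales β, ∀ l, 1 ≤ l → l ≤ 5 → ∀ q : Momentum, |frameLevel μ K q| ≤ dT → ‖iteratedFDeriv ℝ l (evalM (S k)) q‖ ≤ σ k l)
    {ε : ℕ → ℕ → ℝ} (hεnn : ∀ m l, 0 ≤ ε m l)
    (hε0 : ∀ m ∈ Ioc 0 (nScales β), ∀ q : Momentum,
      |frameLevel μ K q| ≤ dT → |evalM (fsub (S m) (S (m - 1))) q| ≤ ε m 0)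
    (hε : ∀ m ∈ Ioc 0 (nScales β), ∀ l, 1 ≤ l → l ≤ 4 → ∀ q : Momentum,
      |frameLevel μ K q| ≤ dT → ‖iteratedFDeriv ℝ l (evalM (fsub (S m) (S (m - 1)))) q‖ ≤ ε m l)
    {X : ℝ} (hX : ∀ l ≤ 4, ∀ x : ℝ, ‖iteratedFDeriv ℝ l salmhoferCutoff x‖ ≤ X) (hdT : msTubeR R U 0 7 ≤ dT)
    {mu nu : ℕ → ℝ} (hmu : ∀ i, 0 ≤ mu i) (hnu : ∀ i, 0 ≤ nu i)
    (hs0 : σ 0 0 ≤ 16 * mu 0 * U ^ 2)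
    (hs1 : ∀ k ≤ nScales β, σ k 1 ≤ 4 * mu 1 * U ^ 2)
    (hs2 : ∀ k ≤ nScales β, σ k 2 ≤ mu 2 * U ^ 2)
    (hs3 : ∀ k ≤ nScales β, σ k 3 ≤ mu 3 * U ^ 2 / 4)
    (hs4 : ∀ k ≤ nScales β, σ k 4 ≤ mu 4 * U ^ 2 / 16)
    (hs5 : ∀ k ≤ nScales β, σ k 5 ≤ mu 5 * U ^ 2 / 64)
    (he0 : ∀ m ∈ Ioc 0 (nScales β), ε m 0 ≤ nu 0 * U ^ 2 * (R.Gfr 0 * U / ((4 : ℝ) ^ m) ^ 2))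
    (he1 : ∀ m ∈ Ioc 0 (nScales β), ε m 1 ≤ nu 1 * U ^ 2 * (R.Gfr 1 * U ^ 2 / (4 : ℝ) ^ m))
    (he2 : ∀ m ∈ Ioc 0 (nScales β), ε m 2 ≤ nu 2 * U ^ 2 * (R.Gfr 2 * U ^ 2))
    (he3 : ∀ m ∈ Ioc 0 (nScales β), ε m 3 ≤ nu 3 * U ^ 2 * (R.Gfr 3 * U ^ 2 * (4 : ℝ) ^ m))
    (he4 : ∀ m ∈ Ioc 0 (nScales β), ε m 4 ≤ nu 4 * U ^ 2 * (R.Gfr 4 * U ^ 2 * ((4 : ℝ) ^ m) ^ 2))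
    (hfit : ∀ j ≤ 4, msReqSlot X (msMuZ mu) (msNuZ nu) (msRenZ R) (8 * π ^ 8) (8 * π ^ 8) j ≤
      64 * ((klEngQ5 P R).CE * klEngGeo5.S 1 * R.Gfr j) / (4 : ℝ) ^ j)
    (hfit0 : ∀ j ≤ 4, msReqBase0 X (msMuZ mu) j ≤ 8 * klEngGeo5.S j / (4 : ℝ) ^ j)
    (hfit1 : ∀ j ≤ 4, U * msReqBase1 X (msMuZ mu) (msRenZ R) (8 * π ^ 8) (8 * π ^ 8) j ≤ 8 * klEngGeo5.S j / (4 : ℝ) ^ j) :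
    TwoLegSizesMSTQ L M klEngGeo5 (klEngQ5 P R) R β U μ K 0 :=
  have hR' : ∀ j, 0 ≤ R.Gfr j := hR.1.2.2
  twoLegSizesMSTQ_zero_of_profiles_tube (L := L) (M := M) hR' hc (le_klCurveC3_div_sixteen_of_le_klEngC₃3 hR' hc3) hU
    (le_klCurveU0_div_sixteen_of_le_klEngU₀4 hR' hUle) (le_one_of_le_klEngU₀4 hR' hUle) hβ hβc hμ hKp ha
    (continuous_klLocalPart_stub hR hc hc3 hU hUle hβ hβc hμ hK L M 0)
    hS hσnn hσ0 hσ hεnn hε0 hε hX (TorusFourierL2.norm_fderiv_frameLevel_le_of_frameOK hK) hdT (klEngQ5_CE_nonneg P R)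
    (klEngQ5_S'_nonneg P R) hmu hnu hs0 hs1 hs2 hs3 hs4 hs5 he0 he1 he2 he3 he4 hfit hfit0 hfit1

/-- **(B) `TwoLegSizesMSTQ … (nScales β + 1)` UNDER THE STUB'S BINDERS FROM THE TOP PROFILE, TUBE symbol sizes** (`0 ≤ dT`):
`twoLegSizesMSTQ_top_of_profiles_tube` at the engine package. -/
theorem twoLegSizesMSTQ_top_of_profiles_tube_stub {P : SplitConsts} {R : RenConsts} {c : ℝ} (hR : R.WF2) (hc : 0 < c) (hc3 : c ≤ klEngC₃3 P R)
    {μ : ℝ} (hμ : μ ∈ klWindowC) {U : ℝ} (hU : 0 < U) (hUle : U ≤ klEngU₀4 P R c) {β : ℝ} (hβ : klBetaMin ≤ β)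
    (hβc : β ≤ Real.exp (c / U ^ 2)) {K : TrigPolyC4v} (hK : FrameOK R U (nScales β) μ K)
    {S : TrigPolyC4v}
    (hS : ∀ θ, klLocalPart L M β U μ K (nScales β + 1) θ - klLocalPart L M β U μ K (nScales β) θ = S.eval (klFermiPoint μ K θ))
    {dT : ℝ} (hdT : 0 ≤ dT) {σ : ℕ → ℝ} (hσnn : ∀ l, 0 ≤ σ l)
    (hσ0 : ∀ q : Momentum, |frameLevel μ K q| ≤ dT → |evalM S q| ≤ σ 0)
    (hσ : ∀ l, 1 ≤ l → l ≤ 4 → ∀ q : Momentum, |frameLevel μ K q| ≤ dT → ‖iteratedFDeriv ℝ l (evalM S) q‖ ≤ σ l)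
    {X : ℝ} (hX : ∀ l ≤ 4, ∀ x : ℝ, ‖iteratedFDeriv ℝ l salmhoferCutoff x‖ ≤ X)
    {mu : ℕ → ℝ} (hmu : ∀ i, 0 ≤ mu i)
    (hs0 : σ 0 ≤ 16 * mu 0 * U ^ 2 / ((4 : ℝ) ^ (nScales β + 1)) ^ 2) (hs1 : σ 1 ≤ 4 * mu 1 * U ^ 2 / (4 : ℝ) ^ (nScales β + 1))
    (hs2 : σ 2 ≤ mu 2 * U ^ 2) (hs3 : σ 3 ≤ mu 3 * U ^ 2 * (4 : ℝ) ^ (nScales β + 1) / 4)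
    (hs4 : σ 4 ≤ mu 4 * U ^ 2 * ((4 : ℝ) ^ (nScales β + 1)) ^ 2 / 16)
    {lam3 lam4 : ℝ} (hlam3 : 0 ≤ lam3) (hlam4 : 0 ≤ lam4)
    (hfit0 : ∀ j ≤ 4, msReqBase0 X mu j ≤ klEngGeo5.S j / 2)
    (hfit1 : ∀ j ≤ 4, U * msReqBase1 X mu R lam3 lam4 j ≤ klEngGeo5.S j / 2) :
    TwoLegSizesMSTQ L M klEngGeo5 (klEngQ5 P R) R β U μ K (nScales β + 1) :=
  have hR' : ∀ j, 0 ≤ R.Gfr j := hR.1.2.2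
  twoLegSizesMSTQ_top_of_profiles_tube (L := L) (M := M) hR' hc (hc3.trans (klEngC₃3_le_klCurveC3 P hR')) hU
    ((le_klEngU₀3_of_le_klEngU₀4 hUle).trans (klEngU₀3_le_klCurveU0 P hR' c)) (le_one_of_le_klEngU₀4 hR' hUle) hβ hβc hμ hK
    (continuous_klLocalPart_stub hR hc hc3 hU hUle hβ hβc hμ hK L M (nScales β + 1))
    (continuous_klLocalPart_stub hR hc hc3 hU hUle hβ hβc hμ hK L M (nScales β)) hS hdT hσnn hσ0 hσ hX (klEngQ5_S'_nonneg P R) hmu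
    hs0 hs1 hs2 hs3 hs4 hlam3 hlam4 hfit0 hfit1

end Summit.HubbardSuperconductivity.HubbardSuperconductivity.Theorems.EngineV8

end
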